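import Summits.AtomisticToContinuum.Crystallization.Theses.HolmgrenBoyleLind
import Summits.AtomisticToContinuum.Crystallization.Theorems.PalmUnimodularRigidityBenjaminiSchrammLimit
import Summits.AtomisticToContinuum.Crystallization.Theorems.HolmgrenBoyleLindGroundStatesChargeFLCEquilibriumLawChargingTransfers
import Summits.AtomisticToContinuum.Crystallization.Theorems.HolmgrenBoyleLindGroundStatesChargeFLCEquilibriumGroundStateNearForce
import Summits.AtomisticToContinuum.Crystallization.Theorems.HolmgrenBoyleLindGroundStatesChargeFLCEquilibriumNearFieldTransfer
import Summits.AtomisticToContinuum.Crystallization.Theorems.HolmgrenBoyleLindGroundStatesChargeFLCEquilibriumHasSumZeroOfPartialSums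
import Summits.AtomisticToContinuum.Crystallization.Theorems.HolmgrenBoyleLindGroundStatesChargeFLCEquilibriumForceBalance

/-!
# Birth skeleton (BC3) for crux `HolmgrenBoyleLind.GroundStatesChargeFLCEquilibrium`
# (item stmt-AtomisticToContinuum-6076 · route `route-AtomisticToContinuum-HolmgrenBoyleLind` · rank 3)

LIM = `GroundStatesChargeFLCEquilibrium`: every sequence of Lennard-Jones ground states `x^N ⊂ ℝ³`
charges, with positive density at every scale `(R, ε)` and frequently in `N`, the patches of ONE
`δ`-separated, `r`-dense set `Λ` of finite local complexity (FLC) in exact Lennard-Jones force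
balance (two-way `ε`-matching of `R`-neighbourhoods with `x_i + A(Λ ∩ B_R(q) − q)`).

THE LINE (the route's TWO-LAYER PLAN "LIM ⇐ NoFoam → PalmLimitFLC → LIM; glue: finite-`N`
criticality ⇒ force balance of limits, portmanteau ⇒ charging"), run through two PROVED tree
theorems — the Benjamini–Schramm limit of ground states `benjaminiSchrammLimit_proof` (item 9230 of
route `PalmUnimodularRigidity`: a subsequence `φ`, a hard core `δ`, a point-stationary law `P` on
rooted configurations with `E_P[h] = lim E(φ j)/φ j`, and the density-transfer clause) and the
energy limit `CrysEnergyLimit_holds` (`E(N)/N → e*`, so `P` is minimising: `E_P[h] ≤ e*`):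

* `stub_minimisingLawsChargeFLC` — THE CONTENT (law level, open-problem strength): every minimising
  point-stationary hard-core law `P` charges, at every scale `(R, ε)` and at one base point `q₀`,
  the patches of ONE FLC Delone set `Λ`; equivalently, some FLC Delone configuration lies (up to a
  linear isometry) in the local-topology support of `P`. Cohesion (no foam: the charged
  configurations have no holes) and finite local complexity of the limit are its two halves
  (BlancLewin2015 §2.2–2.3). Stated with `ε`-fattened patch events, NOT exact patches, because the
  optimal parameters of the charged structure may form a continuum over which `P` is diffuse (cf.
  the parameter-support argument of `palmToHinge_proof`).
* `stub_lawChargingTransfers` — portmanteau / density transfer (size M): law-level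
  `(R, ε)`-charging of the patch of `Λ` at `q` passes, through the density-transfer clause of the
  Benjamini–Schramm limit (applied with radius `R + 1`, tolerance `ε/2`, density `P(T)/2`), to
  `≥ ρ·φ(j)` particles of `x^(φ j)` whose `R`-neighbourhood is two-way `ε`-matched with
  `x_i + A(Λ − q)`, eventually in `j` — the finite-`N` clause of the crux at the base point `q`.
* `stub_forceBalanceOfChargedPatches` — finite-`N` criticality ⇒ force balance of the charged set
  (size M/L, deterministic, no measure theory): if the patches of a `δ'`-separated set `Λ` at ONE
  base point `q₀ ∈ Λ` are two-way `(R, ε)`-matched, at every scale, by neighbourhoods of particles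
  of Lennard-Jones ground states, then `Λ` is in exact force balance at EVERY point `q` (re-base
  from `q₀` to `q` inside the patch of radius `R + |q − q₀| + 1`; Fermat `∇E = 0` at the particle
  matched to `q` — `ExcessDecayLiouvilleForceBalance.sum_erase_force_eq_zero`; near field:
  `ε`-continuity of the finitely many pair forces at fixed `R`, both sides separated
  (`LennardJonesMinimalDistance_holds`, `δ'`); far fields `≤ 2048/(δ³R⁴)`
  (`sum_norm_ljForce_le_of_separated`, `hbl_norm_tsum_sub_sum_le`); absolute summability over `Λ`
  (`hbl_summable_norm_ljForce`) turns "all ball partial sums are `O(R⁻⁴)`" into `HasSum … 0`).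

`GroundStatesChargeFLCEquilibrium_of_stubs : stub₁ → stub₂ → stub₃ → (body of the crux)` is PROVED below
and `GroundStatesChargeFLCEquilibrium_of : GroundStatesChargeFLCEquilibrium` (BY NAME) applies it to the
stubs; RESHAPE (lead c1, 2026-08-17): stub₃ is split into the three registered stubs
`stub_groundStateNearForce` (Fermat + tail inside ground states, S/M), `stub_nearFieldTransfer`
(matching + uniform continuity at fixed radius, M/L) and `stub_hasSumZeroOfPartialSums` (`O(R⁻⁴)`
ball partial sums of an absolutely summable series ⇒ `HasSum … 0`, S/M), recombined by the PROVED
glue `forceBalanceOfChargedPatches_of_stubs`; the only sorries of the file are the five `stub_*`.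

Disproof used: none on file (`ledger crux ls stmt-AtomisticToContinuum-6076`: no Disproof.lean, no
Negative lemmas, negatives index has no law-level / charging statement) at 2026-08-17.
-/

noncomputable section

open MeasureTheory Filter
open scoped ENNReal Topology
open Literature.MathematicalPhysics.StatisticalMechanics

namespace Summit.AtomisticToContinuum.Crystallization.Cruxes.GroundStatesChargeFLCEquilibrium.Birth

/-! ## Registered stubs (the only sorries of the file) -/

/-- **Stub 1 — THE CONTENT (PalmLimitFLC, law level).** Every minimising point-stationary
hard-core probability law `P` on rooted configurations of `ℝ³` (`E_P[h] ≤ e* = ⨅ periodic e(Q)`)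
charges, at every scale `(R, ε)`, the patches at one base point `q₀` of ONE `δ'`-separated,
`r`-dense set `Λ` of finite local complexity: the event "after a linear isometry `A`, the atoms of
`ν` in the ball of radius `R` are two-way `ε`-matched with `A((Λ − q₀) ∩ B_R)`" has positive
`P`-mass. Why plausibly true: if minimising point-stationary laws are carried by rotated relaxed
periodic crystals (the Palm form of crystallization), any configuration in the support of the
(compact) parameter marginal works, exactly as in `palmToHinge_proof`; the statement asks much
less — FLC, not periodicity (quasicrystalline or Wang-type supports would still satisfy it). Why it
might fail: foam (cohesion unproved, BlancLewin2015 §2.2), or a support consisting only of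
configurations with a continuum of local environments. Size: open-problem (crystallization
strength, strictly below periodicity). -/
theorem stub_minimisingLawsChargeFLC :
    ∀ δ : ℝ, 0 < δ → ∀ P : Measure (Measure (EuclideanSpace ℝ (Fin 3))), IsProbabilityMeasure P →
      (∀ᵐ μ ∂P, (∃ S : Set (EuclideanSpace ℝ (Fin 3)), (0 : EuclideanSpace ℝ (Fin 3)) ∈ S ∧
        (∀ x ∈ S, ∀ y ∈ S, x ≠ y → δ ≤ dist x y) ∧
        μ = (Measure.count : Measure (EuclideanSpace ℝ (Fin 3))).restrict S)) →
      (∀ g : Measure (EuclideanSpace ℝ (Fin 3)) → EuclideanSpace ℝ (Fin 3) → ENNReal,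
        Measurable (Function.uncurry g) →
        ∫⁻ μ, ∫⁻ y, g μ y ∂μ ∂P = ∫⁻ μ, ∫⁻ y, g (Measure.map (fun z => z - y) μ) (-y) ∂μ ∂P) →
      (∫ μ, (∫ y, lennardJones ‖y‖ ∂μ) / 2 ∂P) ≤
        (⨅ Q : PeriodicConfiguration 3, Q.energyPerParticle lennardJones) →
      ∃ (Λ : Set (EuclideanSpace ℝ (Fin 3))) (δ' r : ℝ), 0 < δ' ∧ 0 < r ∧
        (∀ x ∈ Λ, ∀ y ∈ Λ, x ≠ y → δ' ≤ dist x y) ∧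
        (∀ c : EuclideanSpace ℝ (Fin 3), ∃ y ∈ Λ, dist y c ≤ r) ∧
        (∀ R : ℝ, Set.Finite {S : Set (EuclideanSpace ℝ (Fin 3)) |
          ∃ x ∈ Λ, S = {v : EuclideanSpace ℝ (Fin 3) | x + v ∈ Λ ∧ ‖v‖ ≤ R}}) ∧
        ∃ q₀ ∈ Λ, ∀ R ε : ℝ, 0 < R → 0 < ε →
          P {ν : Measure (EuclideanSpace ℝ (Fin 3)) |
              ∃ A : EuclideanSpace ℝ (Fin 3) →ₗᵢ[ℝ] EuclideanSpace ℝ (Fin 3),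
                (∀ s ∈ Λ, dist s q₀ ≤ R →
                  ∃ p : EuclideanSpace ℝ (Fin 3), ν {p} ≠ 0 ∧ dist p (A (s - q₀)) ≤ ε) ∧
                (∀ p : EuclideanSpace ℝ (Fin 3), ν {p} ≠ 0 → ‖p‖ ≤ R →
                  ∃ s ∈ Λ, dist p (A (s - q₀)) ≤ ε)} ≠ 0 := by
  sorry

-- stub_lawChargingTransfers: LANDED as `Summit.AtomisticToContinuum.Crystallization.Theorems.HolmgrenBoyleLindGroundStatesChargeFLCEquilibrium.stub_lawChargingTransfers` (imported above).

/-! ### Stub 3 (reshaped) — finite-`N` criticality ⇒ force balance of the charged set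

Let `Λ ⊂ ℝ³` be
`δ'`-separated and `q₀ ∈ Λ`. If for all `R, ε > 0` some particle `i` of some Lennard-Jones ground
state `x` (any `N`) has its `R`-neighbourhood two-way `ε`-matched with `x_i + A(Λ − q₀)` for some
linear isometry `A`, then `Λ` is in exact Lennard-Jones force balance at EVERY point `q`:
`Σ_{y ∈ Λ, y ≠ q} V′(|q − y|)(q − y)/|q − y| = 0` as a `HasSum`. Proof idea: given `q ∈ Λ`, `R ≥ 1`
and `ε` small, take the witness at `q₀` with radius `R + dist q q₀ + 1`; the particle `k` matched
to `x_i + A(q − q₀)` has its own `R`-neighbourhood two-way `2ε`-matched with `x_k + A(Λ − q)`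
(linearity of `A`); Fermat at `k` (`ExcessDecayLiouvilleForceBalance.sum_erase_force_eq_zero`:
ground states are critical, all particles `≥ 1/3` apart by `LennardJonesMinimalDistance_holds`);
the forces of the particles within `R` of `x_k` are `O_R(ε)`-close to `A` applied to the forces of
`(Λ − q) ∩ B_R` (finitely many terms, `V′(t)/t` Lipschitz on `t ≥ min δ' (1/3) / 2`, boundary shell
terms `O(R⁻⁷)` each), and both far fields are `≤ 2048/(δ³R⁴)` (`sum_norm_ljForce_le_of_separated`,
`hbl_norm_tsum_sub_sum_le`); letting `ε → 0` then `R → ∞`, the absolutely convergent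
(`hbl_summable_norm_ljForce`) force series at `q` has all large-ball partial sums `O(R⁻⁴)`, hence
sum `0`. Size: M/L (deterministic analysis, tools in tree).

RESHAPED by the lead (c1, 2026-08-17) into the three registered stubs `stub_groundStateNearForce`
(3a), `stub_nearFieldTransfer` (3b), `stub_hasSumZeroOfPartialSums` (3c) below; this statement is now
the PROVED glue `forceBalanceOfChargedPatches_of_stubs`. -/

-- stub_groundStateNearForce: LANDED as `Summit.AtomisticToContinuum.Crystallization.Theorems.HolmgrenBoyleLindGroundStatesChargeFLCEquilibrium.stub_groundStateNearForce` (imported above).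

-- stub_nearFieldTransfer: LANDED as `Summit.AtomisticToContinuum.Crystallization.Theorems.HolmgrenBoyleLindGroundStatesChargeFLCEquilibrium.stub_nearFieldTransfer` (imported above).

-- stub_hasSumZeroOfPartialSums: LANDED as `Summit.AtomisticToContinuum.Crystallization.Theorems.HolmgrenBoyleLindGroundStatesChargeFLCEquilibrium.stub_hasSumZeroOfPartialSums` (imported above).

-- forceBalanceOfChargedPatches (composition of 3a, 3b, 3c = the pre-reshape stub 3): LANDED as
-- `Summit.AtomisticToContinuum.Crystallization.Theorems.HolmgrenBoyleLindGroundStatesChargeFLCEquilibrium.forceBalanceOfChargedPatches`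
-- (p145552, imported above; registered on the crux item as stub `forceBalanceOfChargedPatches`).

/-! ## The assembly (sorry-free): stub₁ → stub₂ → stub₃ → the crux -/

/-- **The crux from the three stub STATEMENTS** (implication form; the conclusion is the body of
`HolmgrenBoyleLind.GroundStatesChargeFLCEquilibrium` verbatim, so that the ONLY theorem of this file concluding
the crux BY NAME is `GroundStatesChargeFLCEquilibrium_of` below, as the skeleton audit requires). Given a ground-state sequence `x`,
the proved Benjamini–Schramm limit (`benjaminiSchrammLimit_proof`) gives `φ, δ, P` with the
hard-core, point-stationarity, energy and density-transfer clauses; `CrysEnergyLimit_holds` along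
`φ` and uniqueness of limits make `P` minimising; stub 1 gives the FLC Delone set `Λ` charged at the
law level at `q₀ ∈ Λ`; stub 2 transfers the charging to `x^(φ j)` eventually in `j`, hence
frequently in `N` (the crux's clause, base point `q₀`), and in particular supplies, at every scale,
one matched particle of one ground state — the hypothesis of stub 3, which returns exact force
balance of `Λ` at every point. -/
theorem GroundStatesChargeFLCEquilibrium_of_stubs :
    (∀ δ : ℝ, 0 < δ → ∀ P : Measure (Measure (EuclideanSpace ℝ (Fin 3))), IsProbabilityMeasure P →
      (∀ᵐ μ ∂P, (∃ S : Set (EuclideanSpace ℝ (Fin 3)), (0 : EuclideanSpace ℝ (Fin 3)) ∈ S ∧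
        (∀ x ∈ S, ∀ y ∈ S, x ≠ y → δ ≤ dist x y) ∧
        μ = (Measure.count : Measure (EuclideanSpace ℝ (Fin 3))).restrict S)) →
      (∀ g : Measure (EuclideanSpace ℝ (Fin 3)) → EuclideanSpace ℝ (Fin 3) → ENNReal,
        Measurable (Function.uncurry g) →
        ∫⁻ μ, ∫⁻ y, g μ y ∂μ ∂P = ∫⁻ μ, ∫⁻ y, g (Measure.map (fun z => z - y) μ) (-y) ∂μ ∂P) →
      (∫ μ, (∫ y, lennardJones ‖y‖ ∂μ) / 2 ∂P) ≤
        (⨅ Q : PeriodicConfiguration 3, Q.energyPerParticle lennardJones) →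
      ∃ (Λ : Set (EuclideanSpace ℝ (Fin 3))) (δ' r : ℝ), 0 < δ' ∧ 0 < r ∧
        (∀ x ∈ Λ, ∀ y ∈ Λ, x ≠ y → δ' ≤ dist x y) ∧
        (∀ c : EuclideanSpace ℝ (Fin 3), ∃ y ∈ Λ, dist y c ≤ r) ∧
        (∀ R : ℝ, Set.Finite {S : Set (EuclideanSpace ℝ (Fin 3)) |
          ∃ x ∈ Λ, S = {v : EuclideanSpace ℝ (Fin 3) | x + v ∈ Λ ∧ ‖v‖ ≤ R}}) ∧
        ∃ q₀ ∈ Λ, ∀ R ε : ℝ, 0 < R → 0 < ε →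
          P {ν : Measure (EuclideanSpace ℝ (Fin 3)) |
              ∃ A : EuclideanSpace ℝ (Fin 3) →ₗᵢ[ℝ] EuclideanSpace ℝ (Fin 3),
                (∀ s ∈ Λ, dist s q₀ ≤ R →
                  ∃ p : EuclideanSpace ℝ (Fin 3), ν {p} ≠ 0 ∧ dist p (A (s - q₀)) ≤ ε) ∧
                (∀ p : EuclideanSpace ℝ (Fin 3), ν {p} ≠ 0 → ‖p‖ ≤ R →
                  ∃ s ∈ Λ, dist p (A (s - q₀)) ≤ ε)} ≠ 0) →
    (∀ (x : (N : ℕ) → (Fin N → EuclideanSpace ℝ (Fin 3))) (φ : ℕ → ℕ)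
      (P : Measure (Measure (EuclideanSpace ℝ (Fin 3)))), IsProbabilityMeasure P →
      (∀ T : Set (Measure (EuclideanSpace ℝ (Fin 3))), ∀ R ε : ℝ, 0 < ε → ∀ ρ : ℝ,
        ρ < (P T).toReal → ∀ᶠ j : ℕ in Filter.atTop, ρ * (φ j : ℝ) ≤
          (Nat.card {i : Fin (φ j) // ∃ ν ∈ T,
            ((∀ p : EuclideanSpace ℝ (Fin 3), ν {p} ≠ 0 → ‖p‖ ≤ R →
                ∃ q ∈ (Set.range (fun k : Fin (φ j) => x (φ j) k - x (φ j) i)), dist q p ≤ ε) ∧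
              (∀ q ∈ (Set.range (fun k : Fin (φ j) => x (φ j) k - x (φ j) i)), ‖q‖ ≤ R →
                ∃ p : EuclideanSpace ℝ (Fin 3), ν {p} ≠ 0 ∧ dist q p ≤ ε))} : ℝ)) →
      ∀ (Λ : Set (EuclideanSpace ℝ (Fin 3))) (q : EuclideanSpace ℝ (Fin 3)),
        (∀ R ε : ℝ, 0 < R → 0 < ε →
          P {ν : Measure (EuclideanSpace ℝ (Fin 3)) |
              ∃ A : EuclideanSpace ℝ (Fin 3) →ₗᵢ[ℝ] EuclideanSpace ℝ (Fin 3),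
                (∀ s ∈ Λ, dist s q ≤ R →
                  ∃ p : EuclideanSpace ℝ (Fin 3), ν {p} ≠ 0 ∧ dist p (A (s - q)) ≤ ε) ∧
                (∀ p : EuclideanSpace ℝ (Fin 3), ν {p} ≠ 0 → ‖p‖ ≤ R →
                  ∃ s ∈ Λ, dist p (A (s - q)) ≤ ε)} ≠ 0) →
        ∀ R ε : ℝ, 0 < R → 0 < ε → ∃ ρ : ℝ, 0 < ρ ∧ ∀ᶠ j : ℕ in Filter.atTop,
          ρ * (φ j : ℝ) ≤ (Nat.card {i : Fin (φ j) //
            ∃ A : EuclideanSpace ℝ (Fin 3) →ₗᵢ[ℝ] EuclideanSpace ℝ (Fin 3),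
              (∀ s ∈ Λ, dist s q ≤ R →
                ∃ k : Fin (φ j), dist (x (φ j) k) (x (φ j) i + A (s - q)) ≤ ε) ∧
              (∀ k : Fin (φ j), dist (x (φ j) k) (x (φ j) i) ≤ R →
                ∃ s ∈ Λ, dist (x (φ j) k) (x (φ j) i + A (s - q)) ≤ ε)} : ℝ)) →
    (∀ (Λ : Set (EuclideanSpace ℝ (Fin 3))) (δ' : ℝ), 0 < δ' →
      (∀ x ∈ Λ, ∀ y ∈ Λ, x ≠ y → δ' ≤ dist x y) → ∀ q₀ ∈ Λ,
      (∀ R ε : ℝ, 0 < R → 0 < ε →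
        ∃ (N : ℕ) (x : Fin N → EuclideanSpace ℝ (Fin 3)) (i : Fin N)
          (A : EuclideanSpace ℝ (Fin 3) →ₗᵢ[ℝ] EuclideanSpace ℝ (Fin 3)),
          IsGroundState lennardJones x ∧
          (∀ s ∈ Λ, dist s q₀ ≤ R → ∃ j : Fin N, dist (x j) (x i + A (s - q₀)) ≤ ε) ∧
          (∀ j : Fin N, dist (x j) (x i) ≤ R → ∃ s ∈ Λ, dist (x j) (x i + A (s - q₀)) ≤ ε)) →
      ∀ q ∈ Λ, HasSum (fun y : {y : EuclideanSpace ℝ (Fin 3) // y ∈ Λ ∧ y ≠ q} =>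
        (deriv lennardJones (dist q (y : EuclideanSpace ℝ (Fin 3))) /
          dist q (y : EuclideanSpace ℝ (Fin 3))) • (q - (y : EuclideanSpace ℝ (Fin 3)))) 0) →
    -- the crux `HolmgrenBoyleLind.GroundStatesChargeFLCEquilibrium`, body verbatim (definitionally the crux;
    -- the by-name conclusion is `GroundStatesChargeFLCEquilibrium_of` below)
    ∀ x : (N : ℕ) → (Fin N → EuclideanSpace ℝ (Fin 3)), (∀ N, IsGroundState lennardJones (x N)) →
      ∃ (Λ : Set (EuclideanSpace ℝ (Fin 3))) (δ r : ℝ), 0 < δ ∧ 0 < r ∧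
        (∀ x ∈ Λ, ∀ y ∈ Λ, x ≠ y → δ ≤ dist x y) ∧
        (∀ c : EuclideanSpace ℝ (Fin 3), ∃ y ∈ Λ, dist y c ≤ r) ∧
        (∀ R : ℝ, Set.Finite {S : Set (EuclideanSpace ℝ (Fin 3)) |
          ∃ x ∈ Λ, S = {v : EuclideanSpace ℝ (Fin 3) | x + v ∈ Λ ∧ ‖v‖ ≤ R}}) ∧
        (∀ x ∈ Λ, HasSum (fun y : {y : EuclideanSpace ℝ (Fin 3) // y ∈ Λ ∧ y ≠ x} =>
          (deriv lennardJones (dist x (y : EuclideanSpace ℝ (Fin 3))) /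
            dist x (y : EuclideanSpace ℝ (Fin 3))) • (x - (y : EuclideanSpace ℝ (Fin 3)))) 0) ∧
        (∀ R ε : ℝ, 0 < R → 0 < ε → ∃ ρ : ℝ, 0 < ρ ∧ ∃ᶠ N : ℕ in Filter.atTop,
          ρ * (N : ℝ) ≤ (Nat.card {i : Fin N //
            ∃ A : EuclideanSpace ℝ (Fin 3) →ₗᵢ[ℝ] EuclideanSpace ℝ (Fin 3), ∃ q ∈ Λ,
              (∀ s ∈ Λ, dist s q ≤ R → ∃ j : Fin N, dist (x N j) (x N i + A (s - q)) ≤ ε) ∧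
              (∀ j : Fin N, dist (x N j) (x N i) ≤ R →
                ∃ s ∈ Λ, dist (x N j) (x N i + A (s - q)) ≤ ε)} : ℝ)) := by
  intro hFLC hTransfer hBalance x hx
  -- the proved Benjamini–Schramm limit of the ground states (item 9230)
  obtain ⟨φ, hφ, δ, hδ, P, hP, hcore, hstat, hE, htr⟩ :=
    Summit.AtomisticToContinuum.Crystallization.Theorems.benjaminiSchrammLimit_proof x hx
  -- the limit law is minimising: `E_P[h] = lim E(φ j)/φ j = e*` (item 0626, proved)
  have hLim : Filter.Tendsto (fun N : ℕ => groundStateEnergy lennardJones 3 N / N) Filter.atTop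
      (nhds (⨅ Q : PeriodicConfiguration 3, Q.energyPerParticle lennardJones)) :=
    Summit.AtomisticToContinuum.Crystallization.Theses.PalmUnimodularRigidity.CrysEnergyLimit_holds
  have hlim' : Filter.Tendsto (fun j : ℕ => groundStateEnergy lennardJones 3 (φ j) / (φ j : ℝ))
      Filter.atTop (nhds (⨅ Q : PeriodicConfiguration 3, Q.energyPerParticle lennardJones)) :=
    hLim.comp hφ.tendsto_atTop
  have hEq := tendsto_nhds_unique hE hlim'
  -- stub 1: one FLC Delone set charged at the law level at a base point `q₀`
  obtain ⟨Λ, δ', r, hδ', hr, hsep, hden, hflc, q₀, hq₀, hch⟩ := hFLC δ hδ P hP hcore hstat hEq.le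
  -- stub 2: transfer to the configurations `x (φ j)`, eventually in `j`
  have hfin := hTransfer x φ P hP htr Λ q₀ hch
  have hφpos : ∀ᶠ j : ℕ in Filter.atTop, 0 < φ j :=
    hφ.tendsto_atTop.eventually (Filter.eventually_gt_atTop 0)
  refine ⟨Λ, δ', r, hδ', hr, hsep, hden, hflc, ?_, ?_⟩
  · -- force balance at every point: stub 3, fed with one matched particle per scale
    refine hBalance Λ δ' hδ' hsep q₀ hq₀ ?_
    intro R ε hR hε
    obtain ⟨ρ, hρ, hev⟩ := hfin R ε hR hε
    obtain ⟨j, hj, hj0⟩ := (hev.and hφpos).exists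
    have hρN : (0 : ℝ) < ρ * (φ j : ℝ) := mul_pos hρ (Nat.cast_pos.2 hj0)
    have hcard := lt_of_lt_of_le hρN hj
    rw [Nat.cast_pos] at hcard
    obtain ⟨⟨⟨i, A, hA₁, hA₂⟩⟩, -⟩ := Nat.card_pos_iff.1 hcard
    exact ⟨φ j, x (φ j), i, A, hx (φ j), hA₁, hA₂⟩
  · -- the charging clause of the crux, base point `q₀`, frequently in `N`
    intro R ε hR hε
    obtain ⟨ρ, hρ, hev⟩ := hfin R ε hR hε
    refine ⟨ρ, hρ, ?_⟩
    -- the crux's predicate (base point inside) and monotonicity of the count from the base point `q₀`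
    set good : (N : ℕ) → Fin N → Prop := fun N i =>
      ∃ A : EuclideanSpace ℝ (Fin 3) →ₗᵢ[ℝ] EuclideanSpace ℝ (Fin 3), ∃ q ∈ Λ,
        (∀ s ∈ Λ, dist s q ≤ R → ∃ k : Fin N, dist (x N k) (x N i + A (s - q)) ≤ ε) ∧
        (∀ k : Fin N, dist (x N k) (x N i) ≤ R →
          ∃ s ∈ Λ, dist (x N k) (x N i + A (s - q)) ≤ ε)
      with hgood
    have himp : ∀ (N : ℕ) (i : Fin N),
        (∃ A : EuclideanSpace ℝ (Fin 3) →ₗᵢ[ℝ] EuclideanSpace ℝ (Fin 3),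
          (∀ s ∈ Λ, dist s q₀ ≤ R → ∃ k : Fin N, dist (x N k) (x N i + A (s - q₀)) ≤ ε) ∧
          (∀ k : Fin N, dist (x N k) (x N i) ≤ R →
            ∃ s ∈ Λ, dist (x N k) (x N i + A (s - q₀)) ≤ ε)) → good N i :=
      fun N i hi => hi.imp fun A hA => ⟨q₀, hq₀, hA⟩
    have hev' : ∀ᶠ j : ℕ in Filter.atTop,
        ρ * ((φ j : ℕ) : ℝ) ≤ (Nat.card {i : Fin (φ j) // good (φ j) i} : ℝ) := by
      filter_upwards [hev] with j hj
      refine hj.trans ?_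
      exact_mod_cast Nat.card_le_card_of_injective _
        (Subtype.map_injective (fun i hi => himp (φ j) i hi) Function.injective_id)
    exact hφ.tendsto_atTop.frequently
      (p := fun N : ℕ => ρ * (N : ℝ) ≤ (Nat.card {i : Fin N // good N i} : ℝ)) hev'.frequently

/-- **The skeleton concludes the crux BY NAME**: the registered stub 1 and the LANDED stubs 2 and 3
(`stub_lawChargingTransfers`, `forceBalanceOfChargedPatches` = 3a + 3b + 3c) fed into
`GroundStatesChargeFLCEquilibrium_of_stubs`; no sorry of its own (the file's only sorry is
`stub_minimisingLawsChargeFLC`). -/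
theorem GroundStatesChargeFLCEquilibrium_of :
    Summit.AtomisticToContinuum.Crystallization.Theses.HolmgrenBoyleLind.GroundStatesChargeFLCEquilibrium :=
  GroundStatesChargeFLCEquilibrium_of_stubs stub_minimisingLawsChargeFLC
    Summit.AtomisticToContinuum.Crystallization.Theorems.HolmgrenBoyleLindGroundStatesChargeFLCEquilibrium.stub_lawChargingTransfers
    Summit.AtomisticToContinuum.Crystallization.Theorems.HolmgrenBoyleLindGroundStatesChargeFLCEquilibrium.forceBalanceOfChargedPatches

end Summit.AtomisticToContinuum.Crystallization.Cruxes.GroundStatesChargeFLCEquilibrium.Birth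

end
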